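import Summits.FinalStateConjecture.FinalStateConjecture.Theorems.PhaseMixingCaptureBulkKerrCaptureC2CentreGauge
import Summits.FinalStateConjecture.FinalStateConjecture.Theorems.BulkKerrCapture.Negative.SpinGapAndMass
import Literature.Geometry.Lorentzian.KerrSliceDilation
import HarnessLib

/-!
# Crux `PhaseMixingCapture.BulkKerrCaptureC2` (stmt-FinalStateConjecture-14985): every stationary
# competitor in the ball is captured — the conclusion of the crux for data isometric to ANY
# sub-extremal Kerr member, written on the fixed slice `Kerr.slice a M`

Support file, sequel of `PhaseMixingCaptureBulkKerrCaptureC2Centre.lean` (the exact datum `Kerr.data M a M`)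
and `PhaseMixingCaptureBulkKerrCaptureC2CentreGauge.lean` (its compactly supported gauge orbit).  The crux's
matrix `CaptureC2At s δ M _ ε η a` quantifies over data `D` on the FIXED truncated Kerr–Schild slice
`Kerr.slice a M = {t* = 0, r_a > M}` near `Kerr.data M a M`; besides the centre and its gauge images, the
natural test data in that ball are the OTHER members of the Kerr family: the Kerr–Schild data of a nearby
sub-extremal `(M', a')`, transported to the `(a, M)`-slice by a diffeomorphism
`F : Kerr.slice a M ≃ Kerr.slice a' M'` which is asymptotic to the identity (for `δ < −1/2` these lie in
every `H^s_δ`-ball once `|M' − M| + |a' − a|` and `F − id` are small; for `δ ≥ −1/2` different masses are at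
infinite distance and drop out of the b-conormal class).  For such data the conclusion of the crux asks for
far-completeness and `C²`-convergence to a sub-extremal Kerr metric `η`-close to `(M, a)` — and the only
candidate limit is `g_{M',a'}` itself.  This file proves exactly that, for EVERY sub-extremal `(M', a')` and
every far-compatible diffeomorphism `F` (no smallness needed for the conclusion):

* `exists_vacuumCauchyDevelopment_comapAlong` — a vacuum Cauchy development `𝒟 = (𝓜, g, τ, ι, ν)` of a
  datum `D` on `X` re-based along a diffeomorphism `F : N ≃ₜ X` of `3`-manifolds (smooth, injective
  differentials), `(𝓜, g, τ, ι ∘ F, ν ∘ F)`, is a vacuum Cauchy development of `F^* D` with the SAME spacetime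
  (its data embedding is `DataEmbedding.comapAlong`; the tree's `VacuumCauchyDevelopment.precomp` is the case
  `N = X`; stated as an existence theorem, no new definition);
* `hasCompleteFutureNullInfinityFrom_comapAlong` — restricted-origin sojourn completeness of `𝓘⁺` passes
  from origins `A' ⊆ X` to origins `A ⊆ N` along the re-basing whenever `F` maps `A` into `A'` off a compact
  set `C ⊆ N` (reference set `F⁻¹ B₀`, exemption set `F⁻¹ B₁ ∪ C`);
* `exists_goodDevelopment_kerrFamily`, `conclusion_kerrFamily` — for `0 < M'`, `|a'| < M'` and a
  diffeomorphism `F : Kerr.slice a M ≃ₜ Kerr.slice a' M'` mapping far points to far points off a compact set,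
  the datum `F^* Kerr.data M' a' M'` on `Kerr.slice a M` has a good development (the `(M', a')` Kerr slab
  re-based along `F`: far-complete, converging to `g_{M',a'}` in every `Cᵏ`), hence EVERY maximal vacuum
  Cauchy development of it is far-complete and has a region converging in `Cᵏ` to `g_{M',a'}`;
* `captureC2At_kerrFamily` (+ registered stub `stub_captureC2At_kerrFamily`) — so the matrix of the crux
  holds at these data with witness `(M', a')` as soon as `|M' − M| + |a' − a| ≤ η`: within the tolerance, no
  stationary competitor refutes the crux (`not_kerrFamily_of_not_conclusion`).

The centre (`F = Homeomorph.refl`, `(M', a') = (M, a)`) and the gauge orbit (`(M', a') = (M, a)`, `F`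
compactly supported) are the special cases of the two earlier files.  Nothing here closes the crux (off the
stationary family it is the nonlinear asymptotic stability of sub-extremal Kerr); no named fact is consumed.

References: Y. Choquet-Bruhat, R. Geroch, CMP 14 (1969), p. 330 and Thm. 3; H. Ringström, *The Cauchy problem
in General Relativity* (2009), Def. 16.2–16.5; R. Bartnik, J. Isenberg, *The constraint equations* (2004), §2;
D. Christodoulou, CQG 16 (1999) A23, pp. A26–A27; M. Dafermos, I. Rodnianski, arXiv:0811.0354, §2.6.2, §5.1;
M. Dafermos, G. Holzegel, I. Rodnianski, M. Taylor, arXiv:2104.08222, §1.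
-/

-- the doubled `FinalStateConjecture.FinalStateConjecture` path component trips dupNamespace
set_option linter.dupNamespace false

noncomputable section

open Set Filter Function Topology Bundle
open scoped Manifold ContDiff Topology
open Literature.Geometry.Lorentzian
open Summit.FinalStateConjecture.FinalStateConjecture.Theorems.NearExtremalKappaCapture.UnitTemperatureFrontFace.CentreFarComplete
  (farComplete_kerrSlab)
open Summit.FinalStateConjecture.FinalStateConjecture.Theorems.NearExtremalKappaCapture.AreaExcessRatchet
  (farComplete_iff_hasCompleteFutureNullInfinityFar)
open Summit.FinalStateConjecture.FinalStateConjecture.Theorems.BulkKerrCaptureC2.CaptureAscent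
  (hasCompleteFutureNullInfinityFar_of_embedsInto convergesToKerr_of_embedsInto)
open Summit.FinalStateConjecture.FinalStateConjecture.Theorems.BulkKerrCapture.Negative (range_farSliceIncl)

namespace Summit.FinalStateConjecture.FinalStateConjecture.Theorems.BulkKerrCaptureC2.Centre

open NearExtremalKappaCapture.UnitTemperatureFrontFace.KerrSlab

/-! ## §1 Re-basing a vacuum Cauchy development along a diffeomorphism of `3`-manifolds -/

section Rebase

variable {X N : Type} [TopologicalSpace X] [ChartedSpace E3 X] [IsManifold (𝓡 3) ∞ X] [ConnectedSpace X]
  [TopologicalSpace N] [ChartedSpace E3 N] [IsManifold (𝓡 3) ∞ N] [ConnectedSpace N]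
  {D : InitialDataSet (𝓡 3) X}

/-- **Restricted-origin sojourn completeness of `𝓘⁺` passes along the re-basing of a data embedding by a
far-compatible diffeomorphism of the data manifolds.**  If `𝒮 = (𝓜, g, τ, ι, ν)` has complete `𝓘⁺` as seen
from the origins `A' ⊆ X`, and `F : N ≃ₜ X` (smooth, injective differentials) maps the origins `A ⊆ N` into
`A'` off a compact set `C ⊆ N`, then the re-based data embedding `(𝓜, g, τ, ι ∘ F, ν ∘ F)`
(`DataEmbedding.comapAlong`) has complete `𝓘⁺` as seen from `A`: reference set `F⁻¹ B₀` (so that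
`(ι ∘ F)(F⁻¹ B₀) = ι B₀`), exemption set `F⁻¹ B₁ ∪ C`; a normalised null ray from `q ∈ A ∖ (F⁻¹ B₁ ∪ C)` for
`(ι ∘ F, ν ∘ F)` IS one from `F q ∈ A' ∖ B₁` for `(ι, ν)`.  Christodoulou, CQG 16 (1999), pp. A26–A27;
Dafermos–Rodnianski arXiv:0811.0354, §2.6.2. [cite: Christodoulou1999, pp. A26–A27] -/
theorem hasCompleteFutureNullInfinityFrom_comapAlong (𝒮 : DataEmbedding D) (F : N ≃ₜ X)
    (hF : ContMDiff (𝓡 3) (𝓡 3) (∞ + 1) F) (hF' : ∀ u, Injective (mfderiv (𝓡 3) (𝓡 3) F u))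
    (hν : ∀ u, MDifferentiableAt (𝓡 3) (𝓡 (3 + 1)).tangent
      (fun x ↦ (TotalSpace.mk' (EuclideanSpace ℝ (Fin (3 + 1))) (𝒮.embed x) (𝒮.normal x) :
        TangentBundle (𝓡 (3 + 1)) 𝒮.carrier)) (F u))
    {A C : Set N} {A' : Set X} (hC : IsCompact C)
    (hAC : ∀ q ∈ A, q ∉ C → F q ∈ A') (h : 𝒮.HasCompleteFutureNullInfinityFrom A') :
    (𝒮.comapAlong F hF hF' F.isOpenEmbedding hν).HasCompleteFutureNullInfinityFrom A := by
  intro inst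
  haveI : 𝒮.metric.HasLeviCivita := inst
  obtain ⟨B₀, hB₀, H⟩ := @h inst
  refine ⟨F ⁻¹' B₀, F.isCompact_preimage.2 hB₀, fun s hs ↦ ?_⟩
  obtain ⟨B₁, hB₁, H₁⟩ := H s hs
  refine ⟨F ⁻¹' B₁ ∪ C, (F.isCompact_preimage.2 hB₁).union hC, fun q hqA hqB γ dom hγ ↦ ?_⟩
  have hqC : q ∉ C := fun h' ↦ hqB (Or.inr h')
  have hq₁ : F q ∉ B₁ := fun h' ↦ hqB (Or.inl h')
  have hqA' : F q ∈ A' := hAC q hqA hqC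
  have hγ' : 𝒮.metric.IsNormalisedNullRayFrom 𝒮.timeOrientation 𝒮.embed 𝒮.normal (F q) γ dom := hγ
  have himg : (𝒮.embed ∘ F) '' (F ⁻¹' B₀) = 𝒮.embed '' B₀ := by
    rw [Set.image_comp, F.image_preimage]
  change ¬ BddAbove dom ∨ ENNReal.ofReal s ≤
    sojournTime γ dom (𝒮.metric.causalFuture 𝒮.timeOrientation ((𝒮.embed ∘ F) '' (F ⁻¹' B₀)))
  rw [himg]
  exact H₁ (F q) hqA' hq₁ γ dom hγ'

/-- **A vacuum Cauchy development develops the datum re-indexed along a diffeomorphism of `3`-manifolds.**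
For a vacuum Cauchy development `𝒟 = (𝓜, g, τ, ι, ν)` of `D` on `X` and a diffeomorphism `F : N ≃ₜ X`
(a homeomorphism, smooth with injective differentials) there is a vacuum Cauchy development of the
pulled-back datum `F^* D` on `N` whose data embedding IS `(𝓜, g, τ, ι ∘ F, ν ∘ F)`
(`DataEmbedding.comapAlong`): same spacetime, same Cauchy hypersurface `range (ι ∘ F) = range ι`, same
vacuum equations (the tree's `VacuumCauchyDevelopment.precomp` is the case `N = X`).  Choquet-Bruhat–Geroch
1969, p. 330 (the data induced on a hypersurface do not depend on its parametrisation); Ringström 2009,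
Def. 16.2. [cite: ChoquetBruhatGeroch1969CMP, p. 330] -/
theorem exists_vacuumCauchyDevelopment_comapAlong (𝒟 : VacuumCauchyDevelopment D) (F : N ≃ₜ X)
    (hF : ContMDiff (𝓡 3) (𝓡 3) (∞ + 1) F) (hF' : ∀ u, Injective (mfderiv (𝓡 3) (𝓡 3) F u)) :
    ∃ 𝒟' : VacuumCauchyDevelopment (D.comap F hF hF'),
      𝒟'.toDataEmbedding = 𝒟.toDataEmbedding.comapAlong F hF hF' F.isOpenEmbedding
        fun u ↦ 𝒟.toDataEmbedding.mdifferentiableAt_embed_normal (F u) :=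
  ⟨{ toDataEmbedding := 𝒟.toDataEmbedding.comapAlong F hF hF' F.isOpenEmbedding
        (fun u ↦ 𝒟.toDataEmbedding.mdifferentiableAt_embed_normal (F u)),
      isCauchyHypersurface := by
        show 𝒟.metric.IsCauchyHypersurface 𝒟.timeOrientation (range (𝒟.embed ∘ F))
        rw [F.surjective.range_comp]
        exact 𝒟.isCauchyHypersurface,
      isRicciFlat := by
        intro inst
        haveI : 𝒟.metric.toPseudoRiemannianMetric.HasLeviCivita := inst
        exact 𝒟.isRicciFlat }, rfl⟩

end Rebase

/-! ## §2 Stationary competitors: data isometric to a sub-extremal Kerr member, on the fixed slice -/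

section KerrFamily

variable {M a M' a' : ℝ} [Kerr.Facts] [Kerr.SliceFacts]

/-- **Transported Kerr data solve the vacuum constraints**: `F^* Kerr.data M' a' M'` is a vacuum constraint
solution on `Kerr.slice a M` for every smooth `F` with injective differentials
(`InitialDataSet.isVacuumConstraintSolution_comap'`, the constraints of the Kerr data being the tree theorem
`Kerr.data_isVacuumConstraintSolution_holds`). Bartnik–Isenberg 2004, §2. [cite: BartnikIsenberg2004, §2] -/
theorem isVacuumConstraintSolution_kerrFamily (hM' : 0 ≤ M') (F : Kerr.slice a M → Kerr.slice a' M')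
    (hF : ContMDiff (𝓡 3) (𝓡 3) (∞ + 1) F) (hF' : ∀ u, Injective (mfderiv (𝓡 3) (𝓡 3) F u))
    [((Kerr.data M' a' M' hM').comap F hF hF').metric.HasLeviCivita] :
    ((Kerr.data M' a' M' hM').comap F hF hF').IsVacuumConstraintSolution := by
  haveI := (Kerr.data M' a' M' hM').metric.hasLeviCivita
  exact (Kerr.data M' a' M' hM').isVacuumConstraintSolution_comap' hF hF'
    (Kerr.data_isVacuumConstraintSolution_holds M' a' M' hM')

/-- **One good development of a stationary competitor.**  Let `0 < M'`, `|a'| < M'`, and let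
`F : Kerr.slice a M ≃ₜ Kerr.slice a' M'` be a diffeomorphism (smooth, injective differentials) which is
far-compatible: off a compact set `C` it maps the far region `{afRadius a M + 1 ≤ ‖q‖}` of the `(a, M)`-slice
into the far region of the `(a', M')`-slice.  Then the datum `F^* Kerr.data M' a' M'` on `Kerr.slice a M` has,
for every `k`, a vacuum Cauchy development which is far-complete and has a region converging in `Cᵏ` to
`g_{M',a'}`: the `(M', a')` Kerr slab re-based along `F` (`exists_vacuumCauchyDevelopment_comapAlong`; same
spacetime, so `Centre.convergesToKerr_slab`; far-complete by `hasCompleteFutureNullInfinityFrom_comapAlong` and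
`farComplete_kerrSlab`). Dafermos–Rodnianski arXiv:0811.0354, §5.1; Choquet-Bruhat–Geroch 1969, p. 330.
[cite: arXiv08110354, §5.1] -/
theorem exists_goodDevelopment_kerrFamily (hM' : 0 < M') (ha' : |a'| < M') (k : ℕ)
    (F : Kerr.slice a M ≃ₜ Kerr.slice a' M')
    (hF : ContMDiff (𝓡 3) (𝓡 3) (∞ + 1) F) (hF' : ∀ u, Injective (mfderiv (𝓡 3) (𝓡 3) F u))
    {C : Set (Kerr.slice a M)} (hC : IsCompact C)
    (hfar : ∀ q : Kerr.slice a M, Kerr.afRadius a M + 1 ≤ ‖(q : E3)‖ → q ∉ C →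
      Kerr.afRadius a' M' + 1 ≤ ‖(F q : E3)‖) :
    ∃ (𝒟₀ : VacuumCauchyDevelopment ((Kerr.data M' a' M' hM'.le).comap F hF hF'))
      (𝒟oc : Set 𝒟₀.carrier),
      𝒟₀.HasCompleteFutureNullInfinityFar ∧ 𝒟₀.toSpacetime.ConvergesToKerr 𝒟oc M' a' k := by
  -- the `(M', a')` Kerr slab re-based along `F`
  obtain ⟨𝒟₁, h𝒟₁⟩ := exists_vacuumCauchyDevelopment_comapAlong (development hM' ha') F hF hF'
  refine ⟨𝒟₁, ?_⟩
  -- far-completeness of the `(M', a')` slab from the far region of its own slice …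
  have hslab : (development hM' ha').HasCompleteFutureNullInfinityFrom
      {q : Kerr.slice a' M' | Kerr.afRadius a' M' + 1 ≤ ‖(q : E3)‖} := by
    rw [← range_farSliceIncl]
    exact (farComplete_iff_hasCompleteFutureNullInfinityFar _).1 (farComplete_kerrSlab hM' ha')
  -- … passes to the re-based development, seen from the far region of the `(a, M)`-slice
  have hfar' : 𝒟₁.HasCompleteFutureNullInfinityFar := by
    rw [DataEmbedding.hasCompleteFutureNullInfinityFar_iff, range_farSliceIncl, h𝒟₁]
    exact hasCompleteFutureNullInfinityFrom_comapAlong (development hM' ha').toDataEmbedding F hF hF' _ hC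
      (fun q hq hqC ↦ hfar q hq hqC) hslab
  -- the re-based slab has the same spacetime (an equation used as a rewrite, so that no definitional
  -- unfolding of the slab is asked of the kernel)
  have hS : 𝒟₁.toSpacetime = (development hM' ha').toSpacetime :=
    (congrArg DataEmbedding.toSpacetime h𝒟₁).trans
      ((development hM' ha').toDataEmbedding.comapAlong_toSpacetime).1
  have hconv : ∃ 𝒟oc : Set 𝒟₁.toSpacetime.carrier, 𝒟₁.toSpacetime.ConvergesToKerr 𝒟oc M' a' k := by
    rw [hS]
    exact convergesToKerr_slab hM' ha' k
  obtain ⟨𝒟oc, h𝒟oc⟩ := hconv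
  exact ⟨𝒟oc, hfar', h𝒟oc⟩

/-- **The conclusion of the crux at every stationary competitor, every order.**  For `0 < M'`, `|a'| < M'`,
every `k`, every far-compatible diffeomorphism `F : Kerr.slice a M ≃ₜ Kerr.slice a' M'` and every MAXIMAL
vacuum Cauchy development `𝒟` of `F^* Kerr.data M' a' M'`: `𝒟` is far-complete and some region of `𝒟`
converges in `Cᵏ` to `g_{M',a'}` (maximality embeds the good development of
`exists_goodDevelopment_kerrFamily`, and both properties ascend, `CaptureAscent`).  Choquet-Bruhat–Geroch,
CMP 14 (1969), Thm. 3; Ringström 2009, Def. 16.5. [cite: Ringstrom2009, Def. 16.5] -/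
theorem conclusion_kerrFamily (hM' : 0 < M') (ha' : |a'| < M') (k : ℕ)
    (F : Kerr.slice a M ≃ₜ Kerr.slice a' M')
    (hF : ContMDiff (𝓡 3) (𝓡 3) (∞ + 1) F) (hF' : ∀ u, Injective (mfderiv (𝓡 3) (𝓡 3) F u))
    {C : Set (Kerr.slice a M)} (hC : IsCompact C)
    (hfar : ∀ q : Kerr.slice a M, Kerr.afRadius a M + 1 ≤ ‖(q : E3)‖ → q ∉ C →
      Kerr.afRadius a' M' + 1 ≤ ‖(F q : E3)‖)
    (𝒟 : VacuumCauchyDevelopment ((Kerr.data M' a' M' hM'.le).comap F hF hF')) (hmax : 𝒟.IsMaximal) :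
    𝒟.HasCompleteFutureNullInfinityFar ∧
      ∃ 𝒟oc : Set 𝒟.carrier, 𝒟.toSpacetime.ConvergesToKerr 𝒟oc M' a' k := by
  obtain ⟨𝒟₀, 𝒟oc₀, hfar₀, hconv⟩ := exists_goodDevelopment_kerrFamily hM' ha' k F hF hF' hC hfar
  have hemb : 𝒟₀.toCauchyDevelopment.EmbedsInto 𝒟.toCauchyDevelopment := hmax 𝒟₀
  exact ⟨hasCompleteFutureNullInfinityFar_of_embedsInto hemb hfar₀, convergesToKerr_of_embedsInto hemb hconv⟩

/-- **The matrix of the crux at the stationary competitors within the tolerance.**  If moreover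
`|M' − M| + |a' − a| ≤ η`, the conclusion of `CaptureC2At … η a` holds at every MGHD of `F^* Kerr.data M' a' M'`
with witness `(M', a')` (sub-extremal by hypothesis). [cite: Ringstrom2009, Def. 16.5] -/
theorem captureC2At_kerrFamily (hM' : 0 < M') (ha' : |a'| < M') {η : ℝ} (hη : |M' - M| + |a' - a| ≤ η)
    (F : Kerr.slice a M ≃ₜ Kerr.slice a' M')
    (hF : ContMDiff (𝓡 3) (𝓡 3) (∞ + 1) F) (hF' : ∀ u, Injective (mfderiv (𝓡 3) (𝓡 3) F u))
    {C : Set (Kerr.slice a M)} (hC : IsCompact C)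
    (hfar : ∀ q : Kerr.slice a M, Kerr.afRadius a M + 1 ≤ ‖(q : E3)‖ → q ∉ C →
      Kerr.afRadius a' M' + 1 ≤ ‖(F q : E3)‖)
    (𝒟 : VacuumCauchyDevelopment ((Kerr.data M' a' M' hM'.le).comap F hF hF')) (hmax : 𝒟.IsMaximal) :
    ∃ (M'' a'' : ℝ) (𝒟oc : Set 𝒟.carrier), Kerr.IsSubextremal M'' a'' ∧
      𝒟.HasCompleteFutureNullInfinityFar ∧
      𝒟.toSpacetime.ConvergesToKerr 𝒟oc M'' a'' 2 ∧ |M'' - M| + |a'' - a| ≤ η := by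
  obtain ⟨hfar', 𝒟oc, hconv⟩ := conclusion_kerrFamily hM' ha' 2 F hF hF' hC hfar 𝒟 hmax
  exact ⟨M', a', 𝒟oc, ha', hfar', hconv, hη⟩

/-- **No stationary competitor within the tolerance refutes the crux.**  If a datum `D` on `Kerr.slice a M`
has a maximal vacuum Cauchy development violating the conclusion of `CaptureC2At … η a`, then `D` is not of
the form `F^* Kerr.data M' a' M'` with `(M', a')` sub-extremal, `|M' − M| + |a' − a| ≤ η` and `F` a
far-compatible diffeomorphism. [cite: Ringstrom2009, Def. 16.5] -/
theorem not_kerrFamily_of_not_conclusion {η : ℝ} {D : InitialDataSet 𝓘(ℝ, E3) (Kerr.slice a M)}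
    (𝒟 : VacuumCauchyDevelopment D) (hmax : 𝒟.IsMaximal)
    (hbad : ¬ ∃ (M'' a'' : ℝ) (𝒟oc : Set 𝒟.carrier), Kerr.IsSubextremal M'' a'' ∧
      𝒟.HasCompleteFutureNullInfinityFar ∧
      𝒟.toSpacetime.ConvergesToKerr 𝒟oc M'' a'' 2 ∧ |M'' - M| + |a'' - a| ≤ η)
    (hM' : 0 < M') (ha' : |a'| < M') (hη : |M' - M| + |a' - a| ≤ η)
    (F : Kerr.slice a M ≃ₜ Kerr.slice a' M')
    (hF : ContMDiff (𝓡 3) (𝓡 3) (∞ + 1) F) (hF' : ∀ u, Injective (mfderiv (𝓡 3) (𝓡 3) F u))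
    {C : Set (Kerr.slice a M)} (hC : IsCompact C)
    (hfar : ∀ q : Kerr.slice a M, Kerr.afRadius a M + 1 ≤ ‖(q : E3)‖ → q ∉ C →
      Kerr.afRadius a' M' + 1 ≤ ‖(F q : E3)‖) :
    D ≠ (Kerr.data M' a' M' hM'.le).comap F hF hF' := by
  rintro rfl
  exact hbad (captureC2At_kerrFamily hM' ha' hη F hF hF' hC hfar 𝒟 hmax)

/-- **The centre is a stationary competitor** (`F = Homeomorph.refl`, `C = ∅`): the hypotheses of
`conclusion_kerrFamily` are met at `(M', a') = (M, a)` by the identity, so the family of data covered here is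
inhabited in the tree (and `(Homeomorph.refl _)^* Kerr.data M a M = Kerr.data M a M`,
`InitialDataSet.comap_eq_self_of_eq_id`). [folklore] -/
theorem kerrFamily_refl (hM : 0 < M) :
    (∀ q : Kerr.slice a M, Kerr.afRadius a M + 1 ≤ ‖(q : E3)‖ → q ∉ (∅ : Set (Kerr.slice a M)) →
      Kerr.afRadius a M + 1 ≤ ‖((Homeomorph.refl (Kerr.slice a M)) q : E3)‖) ∧
    (Kerr.data M a M hM.le).comap (Homeomorph.refl (Kerr.slice a M)) contMDiff_id
        (fun u ↦ by
          rw [show ⇑(Homeomorph.refl (Kerr.slice a M)) = id from rfl, mfderiv_id]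
          exact fun v w h ↦ h) =
      Kerr.data M a M hM.le :=
  ⟨fun _ hq _ ↦ hq, (Kerr.data M a M hM.le).comap_eq_self_of_eq_id _ _ rfl⟩

end KerrFamily

/-! ## §3 A concrete sub-family: the mass-rescaled Kerr members, transported by the slice dilation -/

section Dilate

variable {M a : ℝ}

/-- The slice dilation `y ↦ l y`, `Kerr.slice a M → Kerr.slice (la) (lM)` (`Kerr.sliceScale`), is smooth
(a restriction of the linear map `l • id`). [folklore] -/
theorem contMDiff_sliceScale {l : ℝ} (hl : 0 < l) (a M : ℝ) :
    ContMDiff 𝓘(ℝ, E3) 𝓘(ℝ, E3) ∞ (Kerr.sliceScale l hl a M) :=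
  (ContMDiff.subtypeVal_comp_iff _ _).1
    ((l • ContinuousLinearMap.id ℝ E3).contDiff.contMDiff.comp contMDiff_subtype_val)

/-- The differential of the slice dilation is `v ↦ l v`. [folklore] -/
theorem mfderiv_sliceScale_apply {l : ℝ} (hl : 0 < l) (y : Kerr.slice a M) (v : E3) :
    mfderiv 𝓘(ℝ, E3) 𝓘(ℝ, E3) (Kerr.sliceScale l hl a M) y v = l • v := by
  rw [OpensChart.mfderiv_apply_of_repr (f := Kerr.sliceScale l hl a M) (Φ := fun y : E3 ↦ l • y)
    (fun y ↦ rfl) ((l • ContinuousLinearMap.id ℝ E3).differentiableAt)]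
  exact congrFun (congrArg DFunLike.coe (l • ContinuousLinearMap.id ℝ E3).fderiv) v

/-- **The slice dilation as a diffeomorphism `Kerr.slice a M ≃ₜ Kerr.slice (la) (lM)`** (the inverse of the
tree's `Kerr.sliceShrinkHomeomorph`): smooth with injective differentials `v ↦ l v`. [folklore] -/
theorem sliceScale_smooth {l : ℝ} (hl : 0 < l) (a M : ℝ) :
    ContMDiff (𝓡 3) (𝓡 3) (∞ + 1) (Kerr.sliceShrinkHomeomorph l hl a M).symm ∧
      ∀ u, Injective (mfderiv (𝓡 3) (𝓡 3) (Kerr.sliceShrinkHomeomorph l hl a M).symm u) := by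
  have h1 : ContMDiff (𝓡 3) (𝓡 3) (∞ + 1) (Kerr.sliceScale l hl a M) :=
    (contMDiff_sliceScale hl a M).of_le (le_of_eq (by rfl))
  refine ⟨h1, fun u v w hvw ↦ ?_⟩
  have hv : mfderiv 𝓘(ℝ, E3) 𝓘(ℝ, E3) (Kerr.sliceScale l hl a M) u v = l • v :=
    mfderiv_sliceScale_apply hl u v
  have hw : mfderiv 𝓘(ℝ, E3) 𝓘(ℝ, E3) (Kerr.sliceScale l hl a M) u w = l • w :=
    mfderiv_sliceScale_apply hl u w
  have h : l • v = l • w := by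
    rw [← hv, ← hw]
    exact hvw
  exact smul_right_injective E3 hl.ne' h

/-- **The slice dilation is far-compatible**: it maps the far region `{afRadius a M + 1 ≤ ‖q‖}` of
`Kerr.slice a M` into the far region of `Kerr.slice (la) (lM)` off the compact norm shell
`{afRadius a M + 1 ≤ ‖q‖ ≤ (afRadius (la) (lM) + 1)/l}` (`‖l q‖ = l ‖q‖`). [folklore] -/
theorem sliceScale_farCompatible (hM : 0 ≤ M) {l : ℝ} (hl : 0 < l) :
    IsCompact {q : Kerr.slice a M | Kerr.afRadius a M + 1 ≤ ‖(q : E3)‖ ∧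
        ‖(q : E3)‖ ≤ (Kerr.afRadius (l * a) (l * M) + 1) / l} ∧
      ∀ q : Kerr.slice a M, Kerr.afRadius a M + 1 ≤ ‖(q : E3)‖ →
        q ∉ {q : Kerr.slice a M | Kerr.afRadius a M + 1 ≤ ‖(q : E3)‖ ∧
          ‖(q : E3)‖ ≤ (Kerr.afRadius (l * a) (l * M) + 1) / l} →
        Kerr.afRadius (l * a) (l * M) + 1 ≤ ‖((Kerr.sliceShrinkHomeomorph l hl a M).symm q : E3)‖ := by
  refine ⟨NearExtremalKappaCapture.UnitTemperatureFrontFace.CentreFarComplete.isCompact_shell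
    fun y hy ↦ NearExtremalKappaCapture.UnitTemperatureFrontFace.CentreFarComplete.mem_slice_of_afRadius_le
      hM hy, fun q hq hqC ↦ ?_⟩
  have hlt : (Kerr.afRadius (l * a) (l * M) + 1) / l < ‖(q : E3)‖ := by
    by_contra h
    exact hqC ⟨hq, not_lt.1 h⟩
  have hcoe : ((Kerr.sliceShrinkHomeomorph l hl a M).symm q : E3) = l • (q : E3) := rfl
  rw [hcoe, norm_smul, Real.norm_of_nonneg hl.le]
  rw [div_lt_iff₀ hl] at hlt
  linarith

variable [Kerr.Facts] [Kerr.SliceFacts]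

/-- **The mass-rescaled Kerr members are captured.**  For `0 < M`, `|a| < M`, every `l > 0`, every `k`, and
every MAXIMAL vacuum Cauchy development `𝒟` of the datum on `Kerr.slice a M` obtained by transporting the
Kerr–Schild data of the rescaled parameters `(lM, la)` along the slice dilation `y ↦ l y`
(`(sliceShrinkHomeomorph l)⁻¹^* Kerr.data (lM) (la) (lM)`; for `l ≠ 1` a datum on the fixed slice distinct
from `Kerr.data M a M`, with a DIFFERENT mass): `𝒟` is far-complete and some region of `𝒟` converges in `Cᵏ`
to `g_{lM, la}` (`conclusion_kerrFamily` at `F` the slice dilation, `sliceScale_smooth`,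
`sliceScale_farCompatible`). Kerr–Schild 1965, §2 (homogeneity); Choquet-Bruhat–Geroch 1969, Thm. 3.
[cite: KerrSchild1965, §2] -/
theorem conclusion_kerrFamily_dilate (hM : 0 < M) (ha : |a| < M) {l : ℝ} (hl : 0 < l) (k : ℕ)
    (𝒟 : VacuumCauchyDevelopment
      ((Kerr.data (l * M) (l * a) (l * M) (mul_pos hl hM).le).comap
        (Kerr.sliceShrinkHomeomorph l hl a M).symm (sliceScale_smooth hl a M).1 (sliceScale_smooth hl a M).2))
    (hmax : 𝒟.IsMaximal) :
    𝒟.HasCompleteFutureNullInfinityFar ∧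
      ∃ 𝒟oc : Set 𝒟.carrier, 𝒟.toSpacetime.ConvergesToKerr 𝒟oc (l * M) (l * a) k := by
  have ha' : |l * a| < l * M := by
    rw [abs_mul, abs_of_pos hl]
    exact mul_lt_mul_of_pos_left ha hl
  obtain ⟨hC, hfar⟩ := sliceScale_farCompatible (a := a) hM.le hl
  exact conclusion_kerrFamily (mul_pos hl hM) ha' k (Kerr.sliceShrinkHomeomorph l hl a M).symm
    (sliceScale_smooth hl a M).1 (sliceScale_smooth hl a M).2 hC hfar 𝒟 hmax

/-- **… and within the tolerance they satisfy the matrix of the crux**: if `|lM − M| + |la − a| ≤ η`, the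
conclusion of `CaptureC2At … η a` holds at every MGHD of the dilation-transported `(lM, la)` Kerr datum,
with witness `(lM, la)`. [cite: KerrSchild1965, §2] -/
theorem captureC2At_kerrFamily_dilate (hM : 0 < M) (ha : |a| < M) {l : ℝ} (hl : 0 < l) {η : ℝ}
    (hη : |l * M - M| + |l * a - a| ≤ η)
    (𝒟 : VacuumCauchyDevelopment
      ((Kerr.data (l * M) (l * a) (l * M) (mul_pos hl hM).le).comap
        (Kerr.sliceShrinkHomeomorph l hl a M).symm (sliceScale_smooth hl a M).1 (sliceScale_smooth hl a M).2))
    (hmax : 𝒟.IsMaximal) :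
    ∃ (M'' a'' : ℝ) (𝒟oc : Set 𝒟.carrier), Kerr.IsSubextremal M'' a'' ∧
      𝒟.HasCompleteFutureNullInfinityFar ∧
      𝒟.toSpacetime.ConvergesToKerr 𝒟oc M'' a'' 2 ∧ |M'' - M| + |a'' - a| ≤ η := by
  have ha' : |l * a| < l * M := by
    rw [abs_mul, abs_of_pos hl]
    exact mul_lt_mul_of_pos_left ha hl
  obtain ⟨hfar', 𝒟oc, hconv⟩ := conclusion_kerrFamily_dilate hM ha hl 2 𝒟 hmax
  exact ⟨l * M, l * a, 𝒟oc, ha', hfar', hconv, hη⟩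

end Dilate

/-- **Registered sub-goal `stub_captureC2At_kerrFamily`** (crux item stmt-FinalStateConjecture-14985): the
matrix `CaptureC2At` of the crux at every stationary competitor within the tolerance — for every
sub-extremal `(M', a')` with `|M' − M| + |a' − a| ≤ η` and every far-compatible diffeomorphism
`F : Kerr.slice a M ≃ₜ Kerr.slice a' M'`, every MGHD of `F^* Kerr.data M' a' M'` is far-complete and has a
region converging in `C²` to a sub-extremal Kerr metric within `η` of `(M, a)` (closed form of
`captureC2At_kerrFamily`, witness `(M', a')`). [cite: Ringstrom2009, Def. 16.5] -/
theorem stub_captureC2At_kerrFamily : ∀ [Kerr.Facts] [Kerr.SliceFacts] (M a M' a' : ℝ) (hM' : 0 < M'), |a'| < M' → ∀ η : ℝ, |M' - M| + |a' - a| ≤ η → ∀ (F : Kerr.slice a M ≃ₜ Kerr.slice a' M') (hF : ContMDiff (𝓡 3) (𝓡 3) (∞ + 1) F) (hF' : ∀ u, Function.Injective (mfderiv (𝓡 3) (𝓡 3) F u)) (C : Set (Kerr.slice a M)), IsCompact C → (∀ q : Kerr.slice a M, Kerr.afRadius a M + 1 ≤ ‖(q : E3)‖ → q ∉ C → Kerr.afRadius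 a' M' + 1 ≤ ‖(F q : E3)‖) → ∀ 𝒟 : VacuumCauchyDevelopment ((Kerr.data M' a' M' hM'.le).comap F hF hF'), 𝒟.IsMaximal → ∃ (M'' a'' : ℝ) (𝒟oc : Set 𝒟.carrier), Kerr.IsSubextremal M'' a'' ∧ 𝒟.HasCompleteFutureNullInfinityFar ∧ 𝒟.toSpacetime.ConvergesToKerr 𝒟oc M'' a'' 2 ∧ |M'' - M| + |a'' - a| ≤ η :=
  fun _ _ _ _ hM' ha' _ hη F hF hF' _ hC hfar 𝒟 hmax ↦
    captureC2At_kerrFamily hM' ha' hη F hF hF' hC hfar 𝒟 hmax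

end Summit.FinalStateConjecture.FinalStateConjecture.Theorems.BulkKerrCaptureC2.Centre

end
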